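import Mathlib
import Summits.Ventures.PercRepro2.SwAllMarkStepClasses

/-!
# Instances of the general mark step (blind cell PercRepro2, night-4 g31, 2026-08-28;
proofs/NIGHT4-G31.md)

Three pairs outside every theorem of record before this step (the census model of g29/g30:
B13 + the leaf-, H-, L- and LH-mark steps), settled by the general mark step on the lane's
classes of the isolated graph:

* `exJ` — `l = 0`, `h = 1`, mark `x = 2` of degree two with the neighbours `3, 4`, where `3` is a
  JUNCTION (no edge to `l`; its other neighbour `4` joined to `h`) touched by the mark:
  **`swAll_exJ : SwAll exJ 0 1 2`** by `swAll_markStep_of_junction` (the series mark with two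
  arbitrary neighbours, one of them a junction);
* `exB` — `l = 0`, `h = 1`, mark `x = 3` of degree three adjacent to `h`, to `2` (joined to `l`)
  and to `4` (not joined to `l`, joined to `h` and `2`): in the isolated graph `4` is separated
  from `h` by its single edge `1–4`: **`swAll_exB : SwAll exB 0 1 3`** by
  `swAll_markStep_of_bridges`;
* `exD` — `l = 0`, `h = 1`, mark `x = 4` of degree FOUR adjacent to `l`, `h`, `2` and `3` (two
  edges to vertices other than `l, h`: outside the L- and LH-mark steps): in the isolated graph `3` is
  separated from `h` by its edge `1–3`: **`swAll_exD : SwAll exD 0 1 4`** by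
  `swAll_markStep_of_bridges`.
-/

namespace Summit.Ventures.PercRepro2

namespace LocRows

open Hull

open scoped Classical

/-- `0–4, 1–3, 1–4, 2–3, 2–4, 3–4`: the mark `2` touches the junction `3`. -/
def exJ : Fin 6 → Sym2 (Fin 5)
  | 0 => s(0, 4) | 1 => s(1, 3) | 2 => s(1, 4) | 3 => s(2, 3) | 4 => s(2, 4) | 5 => s(3, 4)

/-- **Row 2′SW-ALL on `exJ`** with `l = 0`, `h = 1`, the mark `2`: the junction `3` (joined to
`h` through `4`). -/
theorem swAll_exJ : SwAll exJ 0 1 2 := by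
  refine swAll_markStep_of_junction (u := 3) (by decide) (by decide) (by decide) (by decide)
    (by decide) (by decide) (by decide) (by decide) (by decide) ?_
  intro y hy0 hy1 hy3 hy2
  fin_cases y
  · exact absurd rfl hy0
  · exact absurd rfl hy1
  · exact absurd rfl hy2
  · exact absurd rfl hy3
  · exact Or.inl ⟨0, by decide⟩

/-- **Row (SW) on `exJ`.** -/
theorem sw_exJ : Sw exJ 0 1 2 := sw_of_swAll exJ swAll_exJ

/-- `0–2, 1–3, 1–4, 2–3, 2–4, 3–4`: the mark `3` of degree three, adjacent to `h`. -/
def exB : Fin 6 → Sym2 (Fin 5)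
  | 0 => s(0, 2) | 1 => s(1, 3) | 2 => s(1, 4) | 3 => s(2, 3) | 4 => s(2, 4) | 5 => s(3, 4)

/-- The graph `exB` with the edges at `3` deleted (loops at `3`). -/
def exB' : Fin 6 → Sym2 (Fin 5)
  | 0 => s(0, 2) | 1 => s(3, 3) | 2 => s(1, 4) | 3 => s(3, 3) | 4 => s(2, 4) | 5 => s(3, 3)

/-- The isolated graph of `exB` at `3`. -/
theorem isolate_exB : isolate exB 3 = exB' := by
  funext e
  fin_cases e <;> simp [isolate, exB, exB', Sym2.mem_iff]

/-- In `exB'` with `l = 0` removed and the edge `1–4` cut, the component of `h = 1` is `{1}`. -/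
lemma exB'_cluster_cut : cluster exB' (cutConfig exB' ({0}ᶜ) 2) 1 ⊆ {1} := by
  refine cluster_cut_subset (by simp) ?_
  intro e x y hexy hin hne hx
  simp only [Set.mem_singleton_iff] at hx ⊢
  obtain ⟨a, ha, b, hb, hab⟩ := hin
  simp only [Set.mem_compl_iff, Set.mem_singleton_iff] at ha hb
  fin_cases e
  all_goals simp only [exB', Sym2.eq_iff] at hexy hab
  all_goals first | exact absurd rfl hne | omega

/-- **Row 2′SW-ALL on `exB`** with `l = 0`, `h = 1`, the mark `3`: `2` is joined to `l`, `4` is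
separated from `h` by the bridge `1–4` of the isolated graph. -/
theorem swAll_exB : SwAll exB 0 1 3 := by
  refine swAll_markStep_of_bridges (by decide) (by decide) (by decide) (by decide) ?_
  intro y hy0 hy1 hy3
  fin_cases y
  · exact absurd rfl hy0
  · exact absurd rfl hy1
  · exact Or.inl ⟨0, by decide⟩
  · exact absurd rfl hy3
  · refine Or.inr (Or.inr ⟨2, fun hc => ?_⟩)
    rw [isolate_exB] at hc
    have := exB'_cluster_cut hc
    simp at this

/-- **Row (SW) on `exB`.** -/
theorem sw_exB : Sw exB 0 1 3 := sw_of_swAll exB swAll_exB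

/-- `0–2, 0–4, 1–3, 1–4, 2–3, 2–4, 3–4`: the mark `4` of degree four, adjacent to `l`, `h`, `2`
and `3`. -/
def exD : Fin 7 → Sym2 (Fin 5)
  | 0 => s(0, 2) | 1 => s(0, 4) | 2 => s(1, 3) | 3 => s(1, 4) | 4 => s(2, 3) | 5 => s(2, 4)
  | 6 => s(3, 4)

/-- The graph `exD` with the edges at `4` deleted (loops at `4`). -/
def exD' : Fin 7 → Sym2 (Fin 5)
  | 0 => s(0, 2) | 1 => s(4, 4) | 2 => s(1, 3) | 3 => s(4, 4) | 4 => s(2, 3) | 5 => s(4, 4)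
  | 6 => s(4, 4)

/-- The isolated graph of `exD` at `4`. -/
theorem isolate_exD : isolate exD 4 = exD' := by
  funext e
  fin_cases e <;> simp [isolate, exD, exD', Sym2.mem_iff]

/-- In `exD'` with `l = 0` removed and the edge `1–3` cut, the component of `h = 1` is `{1}`. -/
lemma exD'_cluster_cut : cluster exD' (cutConfig exD' ({0}ᶜ) 2) 1 ⊆ {1} := by
  refine cluster_cut_subset (by simp) ?_
  intro e x y hexy hin hne hx
  simp only [Set.mem_singleton_iff] at hx ⊢
  obtain ⟨a, ha, b, hb, hab⟩ := hin
  simp only [Set.mem_compl_iff, Set.mem_singleton_iff] at ha hb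
  fin_cases e
  all_goals simp only [exD', Sym2.eq_iff] at hexy hab
  all_goals first | exact absurd rfl hne | omega

/-- **Row 2′SW-ALL on `exD`** with `l = 0`, `h = 1`, the mark `4` of degree four. -/
theorem swAll_exD : SwAll exD 0 1 4 := by
  refine swAll_markStep_of_bridges (by decide) (by decide) (by decide) (by decide) ?_
  intro y hy0 hy1 hy4
  fin_cases y
  · exact absurd rfl hy0
  · exact absurd rfl hy1
  · exact Or.inl ⟨0, by decide⟩
  · refine Or.inr (Or.inr ⟨2, fun hc => ?_⟩)
    rw [isolate_exD] at hc
    have := exD'_cluster_cut hc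
    simp at this
  · exact absurd rfl hy4

/-- **Row (SW) on `exD`.** -/
theorem sw_exD : Sw exD 0 1 4 := sw_of_swAll exD swAll_exD

end LocRows

end Summit.Ventures.PercRepro2
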